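import Literature.MathematicalPhysics.QuantumFieldTheory.Balaban1983to89.B15AveragingAnalytic
import Literature.MathematicalPhysics.QuantumFieldTheory.Balaban1983to89.B15Prop1StateChartSU2
import Literature.MathematicalPhysics.QuantumFieldTheory.Balaban1983to89.B15Prop1JointHolomorphyFromBackground

/-!
# `Balaban1983to89.B15Prop1ComplexWilsonAction` — [Balaban1989LargeFieldII] = «[LF-II]», (1.10)–(1.11) p. 358 («The expressions in the integral are analytic functions of U»);
# [Balaban1985Variational] = «[15]», (5) p. 278, p. 307 («valid for Gᶜ-valued fields»), (181) p. 307, Sect. G p. 305; [Balaban1987RG1] (0.2) p. 252: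
# THE COMPLEX (TRACE-POLYNOMIAL) WILSON ACTION ON `M₂(ℂ)`-VALUED FIELDS — analytic, `θ`-symmetric (`A(θW) = conj A(W)` on `det = 1`), and its pull-back through the exponential state
# chart: the `a`, `haE`, `ha` of `B15Prop1CriticalChartFromIFT.hMin_of_criticalFamilies`

Honest framing: statement-level skeleton of published theorems with citation tags; proofs where landed; nothing here is a claim about the
Yang–Mills mass gap.  Cell `pub-ymgap`, HUMAN RULING D-0149 (width seats), seat `pub-ymgap-dag-n12-w1` (g2; N12 = [B15]; U1a⁺ of the w1 lineage, U1A-CENSUS §4 item 1 (δ′));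
count-neutral; N12 NOT discharged; finite 𝕋⁴ at fixed ε; nothing continuum ∕ OS ∕ mass-gap ∕ Clay.

WHY.  dag-n12-c's `B15Prop1JointHolomorphyFromBackground` (p583244) reads the Wilson action of an `SU(2)` field as the trace polynomial `Σ_p (1 − tr(U₁U₂·adj U₃·adj U₄)∕2)` in the matrix
entries (`ofReal_wilsonAction4`) and proves its entrywise HOLOMORPHY along families (`differentiableOn_actionSum`) and its bound (`norm_actionSum_le`).  The complex implicit-function route to
(J0′) (`B15Prop1CriticalChartFromIFT`) needs that polynomial as the ACTION `a` of a complex Lagrange system IN COORDINATES: ANALYTIC (class `C^{m+1}`) and CONJUGATION-EQUIVARIANT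
(`a ∘ cE = conj ∘ a`).  THIS MODULE records both for the polynomial — characterised POINTWISE (`hA : ∀ W, A W = Σ_p …`, no new definition) —: analyticity on all of `(bond ↦ M₂(ℂ))` (products,
the entire adjugate `B15AveragingAnalytic.analyticAt_adjugate`, the linear trace), and the `θ`-symmetry `A(θ ∘ W) = conj (A W)` at fields with `det W_b = 1` (`θ(A) = (A⋆)⁻¹` is
multiplicative and commutes with the adjugate — this seat's g0 `star_inv_mul_star_inv`∕`adjugate_star_inv` —, and on `SL₂(ℂ)`: `tr θ(P) = tr adj(P⋆) = tr P⋆ = conj tr P`); then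
through the state chart `χ X = expMulC X ↑U₀` of `B15Prop1StateChartSU2`: `a X := A (expMulC X ↑U₀)` is analytic in `X`, `a (X̄) = conj (a X)`, and at real `X = cplxVec p` it is the real
action `A(exp(ip)·U₀)` of the chart configuration.

CONTENTS (theorems only; no `def`, no `instance`, no `sorry`).  §1 `trace_star_inv_of_det_eq_one` (`tr ((P⋆)⁻¹) = conj (tr P)` on `SL₂(ℂ)`), `det_plaqProd_eq_one`, `plaqProd_theta`,
★ `actionSum_theta` (`A(θ∘W) = conj A(W)` for `det W_b = 1`).  §2 ★ `analyticAt_actionSum` (entire), `contDiffAt_actionSum`.  §3 ★★ `analyticAt_actionSum_expMulC`,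
`actionSum_expMulC_conjVec` (`= conj`), `actionSum_expMulC_cplxVec` (`= ↑(A(expMul su2Chart p U₀))`) — the three inputs `ha`, `haE`, and the real value of the action in
`hMin_of_criticalFamilies`' currency.
-/

noncomputable section

namespace Literature.MathematicalPhysics.QuantumFieldTheory.Balaban1983to89.B15Prop1ComplexWilsonAction

open scoped Topology ContDiff ComplexConjugate
open Literature.MathematicalPhysics.QuantumFieldTheory.Balaban1983to89.Node00 (SU coeField coeField_apply)
open B15AveragingHolomorphic (star_inv_mul_star_inv adjugate_star_inv)
open B15AveragingAnalytic (analyticAt_entry analyticAt_adjugate)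
open B15ComplexifiedDatumFamily (conjVec)
open B15SU2ChartHolomorphic (expMulC)
open B15Prop1StateChartSU2 (expMulC_conjVec_coeField det_expMulC_coeField analyticAt_expMulC_right expMulC_cplxVec_coeField_eq)
open B15Prop1JointHolomorphyFromBackground (ofReal_wilsonAction4)
open B15Prop1AnalyticExtClause (cplxVec)
open B15Prop1ChartCalculusSU2 (E3)
open B15Prop1ChartSU2 (su2Chart)
open B16Sect1Backgrounds (expMul)
open T4CubeChartGnomonic (SU2)
open T4Continuum B15DeterminingSets GaugeField
open scoped Matrix.Norms.L2Operator

/-! ## §1  `θ`-symmetry of the trace polynomial on `SL₂(ℂ)`-valued fields -/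

section Theta

variable {P : Params} {j : ℕ}

/-- On `SL₂(ℂ)`: `tr ((P⋆)⁻¹) = conj (tr P)` (`(P⋆)⁻¹ = adj (P⋆)` as `det P⋆ = 1`; for `2 × 2` matrices `tr adj M = tr M`; `tr (P⋆) = conj tr P`). [cite: Balaban1985Variational, p.307 («Gᶜ-valued fields»; bookkeeping)] -/
theorem trace_star_inv_of_det_eq_one {M : Matrix (Fin 2) (Fin 2) ℂ} (hM : M.det = 1) : ((star M)⁻¹).trace = conj M.trace := by
  have hs : (star M).det = 1 := by rw [Matrix.star_eq_conjTranspose, Matrix.det_conjTranspose, hM, star_one]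
  rw [Matrix.inv_eq_left_inv (by rw [Matrix.adjugate_mul, hs, one_smul] : (star M).adjugate * star M = 1),
    Matrix.adjugate_fin_two, Matrix.trace_fin_two, Matrix.trace_fin_two]
  simp [Matrix.star_apply, add_comm]

/-- The plaquette product `W₁W₂·adj W₃·adj W₄` has determinant one when every `W_b` has. [cite: Balaban1987RG1, (0.2) p.252 (bookkeeping)] -/
theorem det_plaqProd_eq_one {W : PBond P j → Matrix (Fin 2) (Fin 2) ℂ} (hW : ∀ b, (W b).det = 1) (b₁ b₂ b₃ b₄ : PBond P j) :
    (W b₁ * W b₂ * (W b₃).adjugate * (W b₄).adjugate).det = 1 := by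
  rw [Matrix.det_mul, Matrix.det_mul, Matrix.det_mul, Matrix.det_adjugate, Matrix.det_adjugate, hW, hW, hW, hW]
  norm_num

/-- `θ` through the plaquette product: `θW₁·θW₂·adj θW₃·adj θW₄ = θ(W₁W₂·adj W₃·adj W₄)` (`θ` multiplicative, commutes with `adj` on invertibles). [cite: Balaban1985Variational, p.307 (bookkeeping)] -/
theorem plaqProd_theta {W : PBond P j → Matrix (Fin 2) (Fin 2) ℂ} (hW : ∀ b, (W b).det = 1) (b₁ b₂ b₃ b₄ : PBond P j) :
    (star (W b₁))⁻¹ * (star (W b₂))⁻¹ * ((star (W b₃))⁻¹).adjugate * ((star (W b₄))⁻¹).adjugate =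
      (star (W b₁ * W b₂ * (W b₃).adjugate * (W b₄).adjugate))⁻¹ := by
  have hu : ∀ b, IsUnit (W b).det := fun b => by rw [hW]; exact isUnit_one
  rw [← adjugate_star_inv _ (hu b₃), ← adjugate_star_inv _ (hu b₄), star_inv_mul_star_inv, star_inv_mul_star_inv, star_inv_mul_star_inv]

/-- ★ **`θ`-SYMMETRY OF THE COMPLEX WILSON ACTION**: for the trace polynomial `A` (characterised pointwise) and a field with `det W_b = 1`, `A(θ ∘ W) = conj (A W)` — the action half of
«the equations … are valid for Gᶜ-valued fields» read with the UNITARY real structure (fixed set `SU(2)`). [cite: Balaban1985Variational, p.307, (181) p.307; Balaban1989LargeFieldII, (1.10)–(1.11) p.358] -/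
theorem actionSum_theta {A : (PBond P j → Matrix (Fin 2) (Fin 2) ℂ) → ℂ}
    (hA : ∀ W, A W = ∑ p : Plaq P j, (1 - (W ⟨p.src, p.μ⟩ * W ⟨p.src.shift p.μ, p.ν⟩ *
      Matrix.adjugate (W ⟨p.src.shift p.ν, p.μ⟩) * Matrix.adjugate (W ⟨p.src, p.ν⟩)).trace / 2))
    {W : PBond P j → Matrix (Fin 2) (Fin 2) ℂ} (hW : ∀ b, (W b).det = 1) :
    A (fun b => (star (W b))⁻¹) = conj (A W) := by
  rw [hA, hA, map_sum]
  refine Finset.sum_congr rfl fun p _ => ?_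
  rw [plaqProd_theta hW, trace_star_inv_of_det_eq_one (det_plaqProd_eq_one hW _ _ _ _), map_sub, map_one, map_div₀, map_ofNat]

end Theta

/-! ## §2  The trace polynomial is entire -/

section Analytic

variable {P : Params} {j : ℕ}

/-- ★ **THE COMPLEX WILSON ACTION IS ENTIRE** on `(bond ↦ M₂(ℂ))` (evaluations, products, the entire adjugate, the linear trace). [cite: Balaban1989LargeFieldII, (1.10)–(1.11) p.358 («analytic functions of U»); Balaban1985Variational, p.307] -/
theorem analyticAt_actionSum {A : (PBond P j → Matrix (Fin 2) (Fin 2) ℂ) → ℂ}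
    (hA : ∀ W, A W = ∑ p : Plaq P j, (1 - (W ⟨p.src, p.μ⟩ * W ⟨p.src.shift p.μ, p.ν⟩ *
      Matrix.adjugate (W ⟨p.src.shift p.ν, p.μ⟩) * Matrix.adjugate (W ⟨p.src, p.ν⟩)).trace / 2))
    (W₀ : PBond P j → Matrix (Fin 2) (Fin 2) ℂ) : AnalyticAt ℂ A W₀ := by
  have hfun : A = fun W => ∑ p : Plaq P j, (1 - (W ⟨p.src, p.μ⟩ * W ⟨p.src.shift p.μ, p.ν⟩ *
      Matrix.adjugate (W ⟨p.src.shift p.ν, p.μ⟩) * Matrix.adjugate (W ⟨p.src, p.ν⟩)).trace / 2) := funext hA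
  rw [hfun]
  have hev : ∀ b : PBond P j, AnalyticAt ℂ (fun W : PBond P j → Matrix (Fin 2) (Fin 2) ℂ => W b) W₀ := fun b =>
    (ContinuousLinearMap.proj (R := ℂ) (φ := fun _ : PBond P j => Matrix (Fin 2) (Fin 2) ℂ) b).analyticAt W₀
  have hadj : ∀ b : PBond P j, AnalyticAt ℂ (fun W : PBond P j → Matrix (Fin 2) (Fin 2) ℂ => (W b).adjugate) W₀ := fun b =>
    (analyticAt_adjugate _).comp (hev b)
  have htr : ∀ M : Matrix (Fin 2) (Fin 2) ℂ, AnalyticAt ℂ (fun M : Matrix (Fin 2) (Fin 2) ℂ => M.trace) M := fun M =>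
    (LinearMap.toContinuousLinearMap (Matrix.traceLinearMap (Fin 2) ℂ ℂ)).analyticAt M
  refine Finset.analyticAt_fun_sum _ fun p _ => ?_
  refine analyticAt_const.sub (AnalyticAt.div_const ?_ )
  exact (htr _).comp ((((hev _).mul (hev _)).mul (hadj _)).mul (hadj _))

/-- The class `C^n`, every `n ≤ ω`, of the complex Wilson action. [cite: Balaban1989LargeFieldII, (1.10)–(1.11) p.358 (bookkeeping)] -/
theorem contDiffAt_actionSum {A : (PBond P j → Matrix (Fin 2) (Fin 2) ℂ) → ℂ}
    (hA : ∀ W, A W = ∑ p : Plaq P j, (1 - (W ⟨p.src, p.μ⟩ * W ⟨p.src.shift p.μ, p.ν⟩ *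
      Matrix.adjugate (W ⟨p.src.shift p.ν, p.μ⟩) * Matrix.adjugate (W ⟨p.src, p.ν⟩)).trace / 2))
    (W₀ : PBond P j → Matrix (Fin 2) (Fin 2) ℂ) {n : WithTop ℕ∞} : ContDiffAt ℂ n A W₀ :=
  (analyticAt_actionSum hA W₀).contDiffAt

end Analytic

/-! ## §3  Through the exponential state chart at an `SU(2)` configuration: the action `a` of the complex Lagrange system -/

section Chart

variable {P : Params} {j : ℕ}

/-- ★★ **THE ACTION IN COORDINATES IS ANALYTIC**: `X ↦ A (expMulC X ↑U₀)` is analytic everywhere on `PBond P j → ℂ³` — the hypothesis `ha` (any class `C^{m+1}`) of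
`B15Prop1CriticalChartFromIFT.exists_localChart_of_criticalFamily` ∕ `hMin_of_criticalFamilies`. [cite: Balaban1985Variational, Sect. G p.305, Prop. 9 p.309; Balaban1989LargeFieldII, (1.10)–(1.11) p.358] -/
theorem analyticAt_actionSum_expMulC {A : (PBond P j → Matrix (Fin 2) (Fin 2) ℂ) → ℂ}
    (hA : ∀ W, A W = ∑ p : Plaq P j, (1 - (W ⟨p.src, p.μ⟩ * W ⟨p.src.shift p.μ, p.ν⟩ *
      Matrix.adjugate (W ⟨p.src.shift p.ν, p.μ⟩) * Matrix.adjugate (W ⟨p.src, p.ν⟩)).trace / 2))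
    (U₀ : GaugeField P j SU2) (X : VecField P j (EuclideanSpace ℂ (Fin 3))) :
    AnalyticAt ℂ (fun X : VecField P j (EuclideanSpace ℂ (Fin 3)) => A (expMulC X (coeField U₀))) X :=
  (analyticAt_actionSum hA _).comp (analyticAt_expMulC_right (coeField U₀) X)

/-- The class `C^n` of the action in coordinates, every `n ≤ ω`. [cite: Balaban1985Variational, Sect. G p.305 (bookkeeping)] -/
theorem contDiffAt_actionSum_expMulC {A : (PBond P j → Matrix (Fin 2) (Fin 2) ℂ) → ℂ}
    (hA : ∀ W, A W = ∑ p : Plaq P j, (1 - (W ⟨p.src, p.μ⟩ * W ⟨p.src.shift p.μ, p.ν⟩ *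
      Matrix.adjugate (W ⟨p.src.shift p.ν, p.μ⟩) * Matrix.adjugate (W ⟨p.src, p.ν⟩)).trace / 2))
    (U₀ : GaugeField P j SU2) (X : VecField P j (EuclideanSpace ℂ (Fin 3))) {n : WithTop ℕ∞} :
    ContDiffAt ℂ n (fun X : VecField P j (EuclideanSpace ℂ (Fin 3)) => A (expMulC X (coeField U₀))) X :=
  (analyticAt_actionSum_expMulC hA U₀ X).contDiffAt

/-- ★★ **CONJUGATION-EQUIVARIANCE OF THE ACTION IN COORDINATES**: `a (X̄) = conj (a X)` for `a X = A (expMulC X ↑U₀)` — the hypothesis `haE` (the state chart intertwines `conjVec`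
with `θ`, and `A ∘ θ = conj ∘ A` on `det = 1`). [cite: Balaban1985Variational, p.307, (181) p.307, Prop. 9 p.309] -/
theorem actionSum_expMulC_conjVec {A : (PBond P j → Matrix (Fin 2) (Fin 2) ℂ) → ℂ}
    (hA : ∀ W, A W = ∑ p : Plaq P j, (1 - (W ⟨p.src, p.μ⟩ * W ⟨p.src.shift p.μ, p.ν⟩ *
      Matrix.adjugate (W ⟨p.src.shift p.ν, p.μ⟩) * Matrix.adjugate (W ⟨p.src, p.ν⟩)).trace / 2))
    (U₀ : GaugeField P j SU2) (X : VecField P j (EuclideanSpace ℂ (Fin 3))) :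
    A (expMulC (conjVec X) (coeField U₀)) = conj (A (expMulC X (coeField U₀))) := by
  have h : expMulC (conjVec X) (coeField U₀) = fun b => (star (expMulC X (coeField U₀) b))⁻¹ :=
    funext fun b => expMulC_conjVec_coeField U₀ X b
  rw [h]
  exact actionSum_theta hA (det_expMulC_coeField U₀ X)

/-- **THE REAL VALUE**: at a real field `X = cplxVec p` the action in coordinates is the Wilson action (5) of the chart configuration `exp(ip)·U₀` (dag-n12-c's `ofReal_wilsonAction4`).
[cite: Balaban1985Variational, (5) p.278, Sect. G p.305; Balaban1987RG1, (0.2) p.252] -/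
theorem actionSum_expMulC_cplxVec {A : (PBond P j → Matrix (Fin 2) (Fin 2) ℂ) → ℂ}
    (hA : ∀ W, A W = ∑ p : Plaq P j, (1 - (W ⟨p.src, p.μ⟩ * W ⟨p.src.shift p.μ, p.ν⟩ *
      Matrix.adjugate (W ⟨p.src.shift p.ν, p.μ⟩) * Matrix.adjugate (W ⟨p.src, p.ν⟩)).trace / 2))
    (U₀ : GaugeField P j SU2) (p : VecField P j E3) :
    A (expMulC (cplxVec p) (coeField U₀)) = ((wilsonAction4 (expMul su2Chart p U₀) : ℝ) : ℂ) := by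
  rw [expMulC_cplxVec_coeField_eq, hA, ofReal_wilsonAction4]
  rfl

end Chart

end Literature.MathematicalPhysics.QuantumFieldTheory.Balaban1983to89.B15Prop1ComplexWilsonAction

end
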